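import Summits.FinalStateConjecture.FinalStateConjecture.Theorems.SwallowTheDatumSubdataDevelopmentsEmbedGlueSpace

/-!
# Route SwallowTheDatum · item `SubdataDevelopmentsEmbed` (stmt-FinalStateConjecture-10053) —
# the RELATIVE gluing, II: the Lorentzian metric and the time orientation of `M' ∪_U M`
# (relative form of Sbierski 2016, §3.3, proof of Thm. 5)

Sequel to `…GlueSpace.lean` (the gluing datum `d` of a relative common sub-development `(U, ψ)`
of `𝒟'` (data `D₁` on `N`) and `𝒟` (data `D₂` on `X`) over `Φ`, with `d.glue = ψ` on
`d.glue.source = U`). Port of `Literature/…/DevelopmentGluingMetric.lean` to the relative datum,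
in existential form:

* `mfderiv_glue_eq_mfderiv` — on `U` the differential of the gluing map is that of `ψ`;
* `exists_gluedMetric` — **a Lorentzian metric `g̃` on `M̃ = d.Glued` for which
  `π j' = d.inl : M' → M̃` and `π j = d.inr : M → M̃` are isometric immersions** (the metrics
  descend because `ψ` is an isometry on `U`, `SmoothGlueData.exists_metric_of_glue_isometry`;
  Lorentzian signature through the bijective differentials of `inl`, `inr`);
* `exists_gluedTimeOrientation` — **for Hausdorff `M̃`, a time orientation `T̃` of `(M̃, g̃)` for
  which `π j'` and `π j` preserve the time orientations** (the pushed-forward orienting fields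
  lie in one timecone on the overlap because `ψ` preserves the time orientation;
  `SmoothGlueData.exists_timeOrientation_of_glue`).

No definition, no named fact.
-/

noncomputable section

open Function Set Filter Topology TopologicalSpace Bundle Manifold
open scoped Manifold ContDiff Topology
open Literature.Topology.FourManifolds

namespace Summit.FinalStateConjecture.FinalStateConjecture.Theorems

namespace SubdataDevelopmentsEmbed

open Literature.Geometry.Lorentzian

universe u

variable {n : ℕ}
  {N : Type u} [TopologicalSpace N] [ChartedSpace (EuclideanSpace ℝ (Fin n)) N]
  [IsManifold (𝓡 n) ∞ N] [ConnectedSpace N] {D₁ : InitialDataSet (𝓡 n) N}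
  {X : Type u} [TopologicalSpace X] [ChartedSpace (EuclideanSpace ℝ (Fin n)) X]
  [IsManifold (𝓡 n) ∞ X] [ConnectedSpace X] {D₂ : InitialDataSet (𝓡 n) X}

/-! ### The differential of the gluing map -/

/-- **On `U` the gluing map and `ψ` have the same differential** (they agree on the open set
`U`). -/
theorem mfderiv_glue_eq_mfderiv {𝒟' : CauchyDevelopment D₁} {𝒟 : CauchyDevelopment D₂}
    {U : Opens 𝒟'.carrier} {ψ : 𝒟'.carrier → 𝒟.carrier}
    (d : SmoothGlueData (𝓡 (n + 1)) (𝓡 (n + 1)) 𝒟'.carrier 𝒟.carrier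
      (EuclideanSpace ℝ (Fin (n + 1))))
    (hglue : ∀ p (hp : p ∈ U), d.glue p = ψ p) {a : 𝒟'.carrier} (ha : a ∈ U) :
    mfderiv (𝓡 (n + 1)) (𝓡 (n + 1)) d.glue a = mfderiv (𝓡 (n + 1)) (𝓡 (n + 1)) ψ a := by
  have hev : (d.glue : 𝒟'.carrier → 𝒟.carrier) =ᶠ[𝓝 a] ψ := by
    filter_upwards [U.isOpen.mem_nhds ha] with p hp
    exact hglue p hp
  exact hev.mfderiv_eq

/-- **The gluing map is an isometry on the gluing region**, in the form required by
`SmoothGlueData.exists_metric_of_glue_isometry`: `g(dψ v, dψ w) = g'(v, w)` on `U`. -/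
theorem glue_isometry' {𝒟' : CauchyDevelopment D₁} {𝒟 : CauchyDevelopment D₂}
    {U : Opens 𝒟'.carrier} {ψ : 𝒟'.carrier → 𝒟.carrier}
    (hi : ∀ p ∈ U, pullbackBilin (I := 𝓡 (n + 1)) (I' := 𝓡 (n + 1)) ψ 𝒟.metric.val p =
        𝒟'.metric.val p)
    (d : SmoothGlueData (𝓡 (n + 1)) (𝓡 (n + 1)) 𝒟'.carrier 𝒟.carrier
      (EuclideanSpace ℝ (Fin (n + 1))))
    (hsrc : d.glue.source = (U : Set 𝒟'.carrier)) (hglue : ∀ p (hp : p ∈ U), d.glue p = ψ p)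
    (a : 𝒟'.carrier) (ha : a ∈ d.glue.source) (v w : TangentSpace (𝓡 (n + 1)) a) :
    𝒟.metric.toPseudoRiemannianMetric.val (d.glue a)
        (mfderiv (𝓡 (n + 1)) (𝓡 (n + 1)) d.glue a v)
        (mfderiv (𝓡 (n + 1)) (𝓡 (n + 1)) d.glue a w) =
      𝒟'.metric.toPseudoRiemannianMetric.val a v w := by
  have ha' : a ∈ U := by rw [hsrc] at ha; exact ha
  have h := congrArg (fun b ↦ b v w) (hi a ha')
  simp only [pullbackBilin_apply] at h
  rw [mfderiv_glue_eq_mfderiv d hglue ha']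
  have hgen : ∀ p, p = ψ a →
      𝒟.metric.toPseudoRiemannianMetric.val p (mfderiv (𝓡 (n + 1)) (𝓡 (n + 1)) ψ a v)
        (mfderiv (𝓡 (n + 1)) (𝓡 (n + 1)) ψ a w) = 𝒟'.metric.toPseudoRiemannianMetric.val a v w := by
    rintro p rfl
    exact h
  exact hgen _ (hglue a ha')

/-! ### The glued Lorentzian metric -/

/-- **The glued Lorentzian metric.** On the glued space `M̃ = d.Glued` of a relative common
sub-development there is a smooth Lorentzian metric `g̃` for which `π j' = d.inl : M' → M̃` and
`π j = d.inr : M → M̃` are isometric immersions: the pseudo-Riemannian metric of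
`SmoothGlueData.exists_metric_of_glue_isometry` (push forward `g'`, `g` along the open embeddings
and glue, the two agreeing on the overlap since `ψ` is an isometry on `U`, `glue_isometry'`),
which has Lorentzian signature because every tangent space of `M̃` is isometric to one of `M'` or
of `M` through the bijective differential of `inl` or `inr`. Relative form of
`CommonDevelopment.gluedMetric` (Sbierski 2016, §3.3: "we can endow `M̃` with a smooth Lorentzian
metric by pushing forward `g` and `g'` … this turns `π ∘ j` and `π ∘ j'` into isometries"). -/
theorem exists_gluedMetric (𝒟' : CauchyDevelopment D₁) (𝒟 : CauchyDevelopment D₂)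
    {U : Opens 𝒟'.carrier} {ψ : 𝒟'.carrier → 𝒟.carrier}
    (hi : ∀ p ∈ U, pullbackBilin (I := 𝓡 (n + 1)) (I' := 𝓡 (n + 1)) ψ 𝒟.metric.val p =
        𝒟'.metric.val p)
    (d : SmoothGlueData (𝓡 (n + 1)) (𝓡 (n + 1)) 𝒟'.carrier 𝒟.carrier
      (EuclideanSpace ℝ (Fin (n + 1))))
    (hsrc : d.glue.source = (U : Set 𝒟'.carrier)) (hglue : ∀ p (hp : p ∈ U), d.glue p = ψ p) :
    ∃ G : LorentzianMetric (𝓡 (n + 1)) ∞ d.Glued,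
      𝒟'.metric.IsIsometricImmersion G.toPseudoRiemannianMetric d.inl ∧
        𝒟.metric.IsIsometricImmersion G.toPseudoRiemannianMetric d.inr := by
  obtain ⟨g, hgA, hgB⟩ := d.exists_metric_of_glue_isometry 𝒟'.metric.toPseudoRiemannianMetric
    𝒟.metric.toPseudoRiemannianMetric (glue_isometry' hi d hsrc hglue)
  refine ⟨⟨g, fun p ↦ ?_, fun p V W hV hVW hW ↦ ?_⟩,
    ⟨d.contMDiff_inl, fun a ↦ ?_⟩, ⟨d.contMDiff_inr, fun b ↦ ?_⟩⟩
  · -- a timelike vector at every point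
    obtain (⟨a, rfl⟩ | ⟨b, rfl⟩) := d.exists_inl_or_inr p
    · obtain ⟨v, hv⟩ := 𝒟'.metric.exists_timelike a
      exact ⟨mfderiv (𝓡 (n + 1)) (𝓡 (n + 1)) d.inl a v, by rw [hgA]; exact hv⟩
    · obtain ⟨v, hv⟩ := 𝒟.metric.exists_timelike b
      exact ⟨mfderiv (𝓡 (n + 1)) (𝓡 (n + 1)) d.inr b v, by rw [hgB]; exact hv⟩
  · -- the orthogonal complement of a timelike vector is spacelike
    obtain (⟨a, rfl⟩ | ⟨b, rfl⟩) := d.exists_inl_or_inr p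
    · obtain ⟨v, rfl⟩ := (d.mfderiv_inl_bijective a).2 V
      obtain ⟨w, rfl⟩ := (d.mfderiv_inl_bijective a).2 W
      have hw : w ≠ 0 := fun h ↦ hW (by rw [h, map_zero])
      rw [hgA] at hV hVW ⊢
      exact 𝒟'.metric.pos_of_orthogonal a v w hV hVW hw
    · obtain ⟨v, rfl⟩ := (d.mfderiv_inr_bijective b).2 V
      obtain ⟨w, rfl⟩ := (d.mfderiv_inr_bijective b).2 W
      have hw : w ≠ 0 := fun h ↦ hW (by rw [h, map_zero])
      rw [hgB] at hV hVW ⊢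
      exact 𝒟.metric.pos_of_orthogonal b v w hV hVW hw
  · ext v w
    rw [pullbackBilin_apply]
    exact hgA a v w
  · ext v w
    rw [pullbackBilin_apply]
    exact hgB b v w

/-! ### The glued time orientation -/

/-- **The pushed-forward orienting fields of `M'` and `M` lie in one timecone on the overlap**:
for `a ∈ U`, `g̃(d(π j') T'_a, d(π j) T_{ψ a}) < 0` — `d(π j') T'_a = d(π j) (dψ T'_a)`
(`inr ∘ ψ = inl` near `a`), `π j` is an isometry, and `dψ T'_a` is future-directed for `τ`
because `ψ` preserves the time orientation on `U`. Relative form of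
`CommonDevelopment.cone_compat` (Sbierski 2016, §3.3: "since `ψ` preserves the time orientation,
`ψ_*(T|_U)` and `T'|_{ψ(U)}` lie in the same component of the set of all timelike tangent
vectors"). -/
theorem cone_compat' {𝒟' : CauchyDevelopment D₁} {𝒟 : CauchyDevelopment D₂}
    {U : Opens 𝒟'.carrier} {ψ : 𝒟'.carrier → 𝒟.carrier}
    (ht : ∀ p ∈ U, 𝒟.timeOrientation.IsFutureDirected
        (mfderiv (𝓡 (n + 1)) (𝓡 (n + 1)) ψ p (𝒟'.timeOrientation.vectorField p)))
    (d : SmoothGlueData (𝓡 (n + 1)) (𝓡 (n + 1)) 𝒟'.carrier 𝒟.carrier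
      (EuclideanSpace ℝ (Fin (n + 1))))
    (hsrc : d.glue.source = (U : Set 𝒟'.carrier)) (hglue : ∀ p (hp : p ∈ U), d.glue p = ψ p)
    (G : LorentzianMetric (𝓡 (n + 1)) ∞ d.Glued)
    (hr : 𝒟.metric.IsIsometricImmersion G.toPseudoRiemannianMetric d.inr)
    (a : 𝒟'.carrier) (ha : a ∈ d.glue.source) :
    G.val (d.inl a)
        (mfderiv (𝓡 (n + 1)) (𝓡 (n + 1)) d.inl a (𝒟'.timeOrientation.vectorField a))
        (mfderiv (𝓡 (n + 1)) (𝓡 (n + 1)) d.inr (d.glue a)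
          (𝒟.timeOrientation.vectorField (d.glue a))) < 0 := by
  have ha' : a ∈ U := by rw [hsrc] at ha; exact ha
  -- `d(inl) T'_a = d(inr)_{glue a} (dψ T'_a)`
  have h1 : mfderiv (𝓡 (n + 1)) (𝓡 (n + 1)) d.inl a (𝒟'.timeOrientation.vectorField a) =
      mfderiv (𝓡 (n + 1)) (𝓡 (n + 1)) d.inr (d.glue a)
        (mfderiv (𝓡 (n + 1)) (𝓡 (n + 1)) ψ a (𝒟'.timeOrientation.vectorField a)) := by
    rw [d.mfderiv_inl_eq_mfderiv_inr_glue ha, mfderiv_glue_eq_mfderiv d hglue ha']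
    rfl
  -- transport the base point `inl a = inr (glue a)` and read off through the isometry `inr`
  have hbase : d.inl a = d.inr (d.glue a) := (d.inr_glue ha).symm
  have key : ∀ (p : d.Glued), p = d.inr (d.glue a) →
      G.val p (mfderiv (𝓡 (n + 1)) (𝓡 (n + 1)) d.inr (d.glue a)
          (mfderiv (𝓡 (n + 1)) (𝓡 (n + 1)) ψ a (𝒟'.timeOrientation.vectorField a)))
        (mfderiv (𝓡 (n + 1)) (𝓡 (n + 1)) d.inr (d.glue a)
          (𝒟.timeOrientation.vectorField (d.glue a))) < 0 := by
    rintro p rfl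
    have hk := congrArg (fun β ↦ β
      (mfderiv (𝓡 (n + 1)) (𝓡 (n + 1)) ψ a (𝒟'.timeOrientation.vectorField a))
      (𝒟.timeOrientation.vectorField (d.glue a))) (hr.2 (d.glue a))
    simp only [pullbackBilin_apply] at hk
    rw [hk, 𝒟.metric.symm]
    have hgen : ∀ c, c = ψ a →
        𝒟.metric.val c (𝒟.timeOrientation.vectorField c)
          (mfderiv (𝓡 (n + 1)) (𝓡 (n + 1)) ψ a (𝒟'.timeOrientation.vectorField a)) < 0 := by
      rintro c rfl
      exact (ht a ha').2
    exact hgen _ (hglue a ha')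
  rw [h1]
  exact key _ hbase

/-- **The glued time orientation.** If the glued space `M̃` of a relative common sub-development
is Hausdorff, the glued Lorentzian metric `g̃` (any metric for which `π j'`, `π j` are isometric
immersions) admits a time orientation `T̃` for which `π j' : M' → M̃` and `π j : M → M̃` preserve
the time orientations (`SmoothGlueData.exists_timeOrientation_of_glue` fed with the cone
compatibility `cone_compat'`). Relative form of `CommonDevelopment.gluedTimeOrientation`
(Sbierski 2016, §3.3: "`(M̃, g̃)` has a natural time orientation"). -/
theorem exists_gluedTimeOrientation (𝒟' : CauchyDevelopment D₁) (𝒟 : CauchyDevelopment D₂)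
    {U : Opens 𝒟'.carrier} {ψ : 𝒟'.carrier → 𝒟.carrier}
    (ht : ∀ p ∈ U, 𝒟.timeOrientation.IsFutureDirected
        (mfderiv (𝓡 (n + 1)) (𝓡 (n + 1)) ψ p (𝒟'.timeOrientation.vectorField p)))
    (d : SmoothGlueData (𝓡 (n + 1)) (𝓡 (n + 1)) 𝒟'.carrier 𝒟.carrier
      (EuclideanSpace ℝ (Fin (n + 1)))) [T2Space d.Glued]
    (hsrc : d.glue.source = (U : Set 𝒟'.carrier)) (hglue : ∀ p (hp : p ∈ U), d.glue p = ψ p)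
    (G : LorentzianMetric (𝓡 (n + 1)) ∞ d.Glued)
    (hl : 𝒟'.metric.IsIsometricImmersion G.toPseudoRiemannianMetric d.inl)
    (hr : 𝒟.metric.IsIsometricImmersion G.toPseudoRiemannianMetric d.inr) :
    ∃ τ : TimeOrientation G,
      𝒟'.timeOrientation.PreservesTimeOrientation d.inl τ ∧
        𝒟.timeOrientation.PreservesTimeOrientation d.inr τ := by
  have hgA : ∀ (a : 𝒟'.carrier) (v w : TangentSpace (𝓡 (n + 1)) a),
      G.val (d.inl a) (mfderiv (𝓡 (n + 1)) (𝓡 (n + 1)) d.inl a v)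
        (mfderiv (𝓡 (n + 1)) (𝓡 (n + 1)) d.inl a w) = 𝒟'.metric.val a v w := fun a v w ↦ by
    have h := congrArg (fun β ↦ β v w) (hl.2 a)
    simp only [pullbackBilin_apply] at h
    exact h
  have hgB : ∀ (b : 𝒟.carrier) (v w : TangentSpace (𝓡 (n + 1)) b),
      G.val (d.inr b) (mfderiv (𝓡 (n + 1)) (𝓡 (n + 1)) d.inr b v)
        (mfderiv (𝓡 (n + 1)) (𝓡 (n + 1)) d.inr b w) = 𝒟.metric.val b v w := fun b v w ↦ by
    have h := congrArg (fun β ↦ β v w) (hr.2 b)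
    simp only [pullbackBilin_apply] at h
    exact h
  obtain ⟨τ, hτl, hτr⟩ := d.exists_timeOrientation_of_glue 𝒟'.timeOrientation 𝒟.timeOrientation
    G hgA hgB (cone_compat' ht d hsrc hglue G hr)
  exact ⟨τ, fun a ↦ hτl a, fun b ↦ hτr b⟩

/-- **The glued spacetime structure, existentially**: for a relative common sub-development
without corresponding boundary points (Hausdorff glued space), the glued space carries a
Lorentzian metric and a time orientation for which both pieces `π j' : M' → M̃`, `π j : M → M̃`
are time-orientation preserving isometric immersions. -/
theorem exists_gluedMetric_timeOrientation (𝒟' : CauchyDevelopment D₁) (𝒟 : CauchyDevelopment D₂)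
    {U : Opens 𝒟'.carrier} {ψ : 𝒟'.carrier → 𝒟.carrier}
    (hi : ∀ p ∈ U, pullbackBilin (I := 𝓡 (n + 1)) (I' := 𝓡 (n + 1)) ψ 𝒟.metric.val p =
        𝒟'.metric.val p)
    (ht : ∀ p ∈ U, 𝒟.timeOrientation.IsFutureDirected
        (mfderiv (𝓡 (n + 1)) (𝓡 (n + 1)) ψ p (𝒟'.timeOrientation.vectorField p)))
    (d : SmoothGlueData (𝓡 (n + 1)) (𝓡 (n + 1)) 𝒟'.carrier 𝒟.carrier
      (EuclideanSpace ℝ (Fin (n + 1)))) [T2Space d.Glued]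
    (hsrc : d.glue.source = (U : Set 𝒟'.carrier)) (hglue : ∀ p (hp : p ∈ U), d.glue p = ψ p) :
    ∃ (G : LorentzianMetric (𝓡 (n + 1)) ∞ d.Glued) (τ : TimeOrientation G),
      𝒟'.metric.IsIsometricImmersion G.toPseudoRiemannianMetric d.inl ∧
        𝒟.metric.IsIsometricImmersion G.toPseudoRiemannianMetric d.inr ∧
        𝒟'.timeOrientation.PreservesTimeOrientation d.inl τ ∧
        𝒟.timeOrientation.PreservesTimeOrientation d.inr τ := by
  obtain ⟨G, hl, hr⟩ := exists_gluedMetric 𝒟' 𝒟 hi d hsrc hglue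
  obtain ⟨τ, hτl, hτr⟩ := exists_gluedTimeOrientation 𝒟' 𝒟 ht d hsrc hglue G hl hr
  exact ⟨G, τ, hl, hr, hτl, hτr⟩

end SubdataDevelopmentsEmbed

end Summit.FinalStateConjecture.FinalStateConjecture.Theorems

end
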